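import Summits.Ventures.YMGap.Thresholds.OneLinkLevelTwoBootTildeEnvelope
import Summits.Ventures.YMGap.Thresholds.OneLinkLevelTwoBootAreaLaw
import HarnessLib

/-!
# Venture YMGap — the one-link modulus beyond first order, part 55: Wilson AREA LAW rows of the `ω̃` bootstrap modulus `K₂BT`
# through the slab door — `HasAreaLaw d (fundamentalRep (Fin N)) (N·β)` for every `d ≥ 2`, every `N ≥ 4 / 6 / 10 / 20 / 50`

HONEST FRAMING: venture file of the cell `pub-ymgap` (QuantumFields programme), strong-coupling LATTICE statements for `SU(N)`
lattice Yang–Mills on the `d`-dimensional torus (Wilson action, tree coupling `N·β`, 't Hooft `β`), volume-uniform finite-volume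
area law `HasAreaLaw` (constructive-qft.S12); nothing about the continuum, the string tension's value, or the mass gap.  Kernel
ARITHMETIC over tree theorems, exactly as `OneLinkLevelTwoBootAreaLaw` (slab door `Slab.hasAreaLaw_of_oneLinkKRModulus` + the tree
theorem `durhuusFrohlich_areaLaw_of_slabClustering_holds` + `slab_door_of_envelope`), with the `ω̃` bootstrap modulus at a rational
bracket (`oneLinkKRModulus_levelTwoBT_bracket` of `OneLinkLevelTwoBootTildeRows`, copied here as a private helper, radius `R₀ ≥ 2(d−1)β`; door `R₀·K̄₂BT < 1` by `norm_num`) in place of `K₂B`: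
* `hasAreaLaw_SU_levelTwoBT_four (2 ≤ d) (4 ≤ N) (0 ≤ β) (2(d−1)β ≤ 139 / 500)`, `d = 4`: `β ≤ 139 / 3000 = 0.0463` (`K₂B`: `2(d−1)β ≤ 69/250`);
* `hasAreaLaw_SU_levelTwoBT_six (2 ≤ d) (6 ≤ N) (0 ≤ β) (2(d−1)β ≤ 3 / 10)`, `d = 4`: `β ≤ 1 / 20 = 0.0500` (`K₂B`: `2(d−1)β ≤ 119/400`);
* `hasAreaLaw_SU_levelTwoBT_ten (2 ≤ d) (10 ≤ N) (0 ≤ β) (2(d−1)β ≤ 19 / 60)`, `d = 4`: `β ≤ 19 / 360 = 0.0528` (`K₂B`: `2(d−1)β ≤ 31/100`);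
* `hasAreaLaw_SU_levelTwoBT_twenty (2 ≤ d) (20 ≤ N) (0 ≤ β) (2(d−1)β ≤ 81 / 250)`, `d = 4`: `β ≤ 27 / 500 = 0.0540` (`K₂B`: `2(d−1)β ≤ 63/200`);
* `hasAreaLaw_SU_levelTwoBT_fifty (2 ≤ d) (50 ≤ N) (0 ≤ β) (2(d−1)β ≤ 49 / 150)`, `d = 4`: `β ≤ 49 / 900 = 0.0544` (`K₂B`: `2(d−1)β ≤ 317/1000`);
each with its `d = 4` instance `…_d4`, and `areaLaw_numbers_levelTwoBT`.  Printed Cao–Nissim–Sheffield (all `N`): `2(d−1)β < 1/4`,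
`d = 4`: `1/24 ≈ 0.0417` — now reached for every `N ≥ 6` at `β ≤ 1/20` and for `N ≥ 20` at `β ≤ 27/500`.  CLASS: K (no hypothesis).
Sentence-grade.  Exact rationals: cell folder `work/hier/rows_pick_bt.py` / `rows_check_bt.py` (margins `0.2–4.1 %`).
-/

noncomputable section

open scoped Matrix ComplexConjugate BigOperators ContDiff Matrix.Norms.Frobenius
open Matrix Complex Finset MeasureTheory ProbabilityTheory
open Literature.MathematicalPhysics.QuantumLattice
open Literature.MathematicalPhysics.QuantumFieldTheory
open Literature.MathematicalPhysics.QuantumFieldTheory.SUNBakryEmery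
open Literature.MathematicalPhysics.QuantumFieldTheory.Balaban1983to89.StrongCouplingDobrushinWindow
open Literature.MathematicalPhysics.QuantumFieldTheory.Balaban1983to89.StrongCouplingKernelWindow

namespace Summit.Ventures.YMGap.OneLinkEigen

variable {N : ℕ}

section LevelTwoBTAreaLaw

open Summit.Ventures.YMGap.Slab (hasAreaLaw_of_oneLinkKRModulus)
open Summit.Ventures.YMGap.OneLinkEigenRows (casimirFactor_le)

/-- (Local `private` copy of `OneLinkLevelTwoBootTildeRows.oneLinkKRModulus_levelTwoBT_bracket`, so that this file does not
wait for that module's build.)  **The `ω̃`-bootstrap modulus at a rational bracket**: for `N ≥ N₀ ≥ 3`, `R₀ < 1/2` and rationals `q, p, t, u ≥ 0` with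
`q² ≥ R₀²/4 + 1/N₀²`, `p² ≥ (1 + ω̄⁺)/2`, `t² ≥ b̄²/4 + c̄`, `u² ≥ (τ̄ + R₀²)²/16 + R₀²/N₀²`:
`OneLinkKRModulus N R₀ (K̄₂BT(N₀,R₀; q,p,t,u))`, `K̄₂BT = C(N₀)(p + E(N₀)R₀ + 2(E(N₀)+¼)ω̃̄ + ((3/2)E(N₀)R₀² + (2E(N₀)+¼)τ̄ + (10E(N₀)+½)R₀ω̃̄)/(½−R₀)
+ (3/2)E(N₀)R₀²·K̄₂QT)` — the row socket (the constant is produced by unification, never written). [folklore] -/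
private theorem levelTwoBT_bracket_local {N₀ : ℕ} (hN₀ : 3 ≤ N₀) (hN : N₀ ≤ N) {R₀ q p t u : ℝ} (hR0 : 0 ≤ R₀) (hR₀ : R₀ < 1 / 2)
    (hq : 0 ≤ q) (hq2 : R₀ ^ 2 / 4 + 1 / (N₀ : ℝ) ^ 2 ≤ q ^ 2) (hp : 0 ≤ p)
    (hp2 : (1 + ((2 * ((2 * (N₀ : ℝ) ^ 2 - 4) / (4 * (N₀ : ℝ) ^ 2 - 20)) * ((R₀) + ((R₀) ^ 2 / 2 + (R₀) * (q))) + 2 * (2 * (N₀ : ℝ) ^ 2 / (4 * (N₀ : ℝ) ^ 2 - 20)) * (((R₀) ^ 2 / 2 + (R₀) * (q)) + (R₀) * ((R₀) / 2 + (q)) ^ 2)))) / 2 ≤ p ^ 2) (ht : 0 ≤ t)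
    (ht2 : ((R₀) ^ 2 * (1 + (R₀) / 2 + (q)) / (2 - 4 / (N₀ : ℝ) ^ 2)) ^ 2 / 4 + ((R₀) ^ 2 * (4 / (N₀ : ℝ) ^ 2 + 2 * ((R₀) / 2 + (q)) ^ 2) / (2 - 4 / (N₀ : ℝ) ^ 2)) ≤ t ^ 2) (hu : 0 ≤ u)
    (hu2 : (((R₀) * (((R₀) ^ 2 * (1 + (R₀) / 2 + (q)) / (2 - 4 / (N₀ : ℝ) ^ 2)) / 2 + (t))) + R₀ ^ 2) ^ 2 / 16 + R₀ ^ 2 / (N₀ : ℝ) ^ 2 ≤ u ^ 2) :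
    OneLinkKRModulus N R₀
      (((N₀ : ℝ) ^ 2 / ((N₀ : ℝ) ^ 2 - 1)) *
        ((p) + ((N₀ : ℝ) ^ 2 / (2 * ((N₀ : ℝ) ^ 2 - 4))) * (R₀) + 2 * (((N₀ : ℝ) ^ 2 / (2 * ((N₀ : ℝ) ^ 2 - 4))) + 1 / 4) * ((((R₀) * (((R₀) ^ 2 * (1 + (R₀) / 2 + (q)) / (2 - 4 / (N₀ : ℝ) ^ 2)) / 2 + (t))) + (R₀) ^ 2) / 4 + (u))
          + (3 / 2 * ((N₀ : ℝ) ^ 2 / (2 * ((N₀ : ℝ) ^ 2 - 4))) * (R₀) ^ 2 + (2 * ((N₀ : ℝ) ^ 2 / (2 * ((N₀ : ℝ) ^ 2 - 4))) + 1 / 4) * ((R₀) * (((R₀) ^ 2 * (1 + (R₀) / 2 + (q)) / (2 - 4 / (N₀ : ℝ) ^ 2)) / 2 + (t)))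
              + (10 * ((N₀ : ℝ) ^ 2 / (2 * ((N₀ : ℝ) ^ 2 - 4))) + 1 / 2) * (R₀) * ((((R₀) * (((R₀) ^ 2 * (1 + (R₀) / 2 + (q)) / (2 - 4 / (N₀ : ℝ) ^ 2)) / 2 + (t))) + (R₀) ^ 2) / 4 + (u))) / (1 / 2 - (R₀))
          + 3 / 2 * ((N₀ : ℝ) ^ 2 / (2 * ((N₀ : ℝ) ^ 2 - 4))) * (R₀) ^ 2 * (((N₀ : ℝ) ^ 2 / ((N₀ : ℝ) ^ 2 - 1)) *
        ((p) + ((N₀ : ℝ) ^ 2 / (2 * ((N₀ : ℝ) ^ 2 - 4))) * (R₀) + 2 * (((N₀ : ℝ) ^ 2 / (2 * ((N₀ : ℝ) ^ 2 - 4))) + 1 / 4) * ((((R₀) * (((R₀) ^ 2 * (1 + (R₀) / 2 + (q)) / (2 - 4 / (N₀ : ℝ) ^ 2)) / 2 + (t))) + (R₀) ^ 2) / 4 + (u))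
          + (3 * ((N₀ : ℝ) ^ 2 / (2 * ((N₀ : ℝ) ^ 2 - 4))) * (R₀) ^ 2 + (2 * ((N₀ : ℝ) ^ 2 / (2 * ((N₀ : ℝ) ^ 2 - 4))) + 1 / 4) * ((R₀) * (((R₀) ^ 2 * (1 + (R₀) / 2 + (q)) / (2 - 4 / (N₀ : ℝ) ^ 2)) / 2 + (t)))
              + (10 * ((N₀ : ℝ) ^ 2 / (2 * ((N₀ : ℝ) ^ 2 - 4))) + 1 / 2) * (R₀) * ((((R₀) * (((R₀) ^ 2 * (1 + (R₀) / 2 + (q)) / (2 - 4 / (N₀ : ℝ) ^ 2)) / 2 + (t))) + (R₀) ^ 2) / 4 + (u))) / (1 / 2 - (R₀)))))) :=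
  oneLinkKRModulus_levelTwoBT_of_le (le_trans hN₀ hN) le_rfl hR₀ (casimirFactor_le (by omega) hN) (levelTwoE_le hN₀ hN)
    (sqrt_omegaPlus_le hN₀ hN hR0 le_rfl hq hq2 hp hp2) (omegaTilde_le hN₀ hN hR0 le_rfl hq hq2 ht ht2 hu hu2)
    (tau_le hN₀ hN hR0 le_rfl hq hq2 ht ht2) (levelTwoQTK_le hN₀ hN hR0 le_rfl hR₀ hq hq2 hp hp2 ht ht2 hu hu2)


/-- **`SU(N)` Wilson AREA LAW in every dimension `d ≥ 2`, for every `N ≥ 4` and every 't Hooft `0 ≤ β` with `2(d−1)β ≤ 139 / 500`**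
(`d = 4`: `β ≤ 139 / 3000 = 0.0463`; `K₂B` column `69/250`; printed Cao–Nissim–Sheffield `β < 1/(8(d−1))`) — hypothesis-free: the slab door with
the `ω̃`-bootstrap modulus at the bracket `R₀ = 139 / 500`, `q = 2861 / 10000`, `p = 1169 / 1250`, `t = 16731 / 100000`, `u = 77 / 1000` (`R₀·K̄₂BT = 0.98849 < 1` by `norm_num`)
and the tree theorem `durhuusFrohlich_areaLaw_of_slabClustering_holds`. [cite: CaoNissimSheffield2025dynamical, Theorems 1.6 and 2.3] -/
theorem hasAreaLaw_SU_levelTwoBT_four {d : ℕ} (hd : 2 ≤ d) (hN : 4 ≤ N) {β : ℝ} (hβ : 0 ≤ β)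
    (h : β * (2 * ((d : ℝ) - 1)) ≤ 139 / 500) : HasAreaLaw d (fundamentalRep (Fin N)) ((N : ℝ) * β) := by
  have hd1 : (0 : ℝ) ≤ (d : ℝ) - 1 := by
    have : (2 : ℝ) ≤ d := by exact_mod_cast hd
    linarith
  have hR0 : 0 ≤ 2 * ((d : ℝ) - 1) * β := by positivity
  have e : 2 * ((d : ℝ) - 1) * β = β * (2 * ((d : ℝ) - 1)) := by ring
  have hR : 2 * ((d : ℝ) - 1) * β ≤ 139 / 500 := e.le.trans h
  have hmod := levelTwoBT_bracket_local (N₀ := 4) (N := N) (by norm_num) hN (R₀ := 139 / 500) (q := 2861 / 10000) (p := 1169 / 1250)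
    (t := 16731 / 100000) (u := 77 / 1000) (by norm_num) (by norm_num) (by norm_num) (by norm_num) (by norm_num) (by norm_num) (by norm_num)
    (by norm_num) (by norm_num) (by norm_num)
  refine hasAreaLaw_of_oneLinkKRModulus durhuusFrohlich_areaLaw_of_slabClustering_holds hd (by omega) hβ ?_ h hmod
    (slab_door_of_envelope le_rfl hR hR0 ?_ ?_) <;> norm_num

/-- `d = 4`: **`SU(N)` Wilson AREA LAW for every `N ≥ 4` at every 't Hooft `0 ≤ β ≤ 139 / 3000`** (`0.0463`; tree coupling `N·β`;
printed Cao–Nissim–Sheffield: `β < 1/24 ≈ 0.0417`), hypothesis-free. [cite: CaoNissimSheffield2025dynamical, Theorems 1.6 and 2.3] -/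
theorem hasAreaLaw_SU_levelTwoBT_four_d4 (hN : 4 ≤ N) {β : ℝ} (hβ : 0 ≤ β) (h : β ≤ 139 / 3000) :
    HasAreaLaw 4 (fundamentalRep (Fin N)) ((N : ℝ) * β) :=
  hasAreaLaw_SU_levelTwoBT_four (d := 4) (by norm_num) hN hβ (by norm_num; linarith)

/-- **`SU(N)` Wilson AREA LAW in every dimension `d ≥ 2`, for every `N ≥ 6` and every 't Hooft `0 ≤ β` with `2(d−1)β ≤ 3 / 10`**
(`d = 4`: `β ≤ 1 / 20 = 0.0500`; `K₂B` column `119/400`; printed Cao–Nissim–Sheffield `β < 1/(8(d−1))`) — hypothesis-free: the slab door with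
the `ω̃`-bootstrap modulus at the bracket `R₀ = 3 / 10`, `q = 2243 / 10000`, `p = 1129 / 1250`, `t = 7021 / 50000`, `u = 1533 / 25000` (`R₀·K̄₂BT = 0.95910 < 1` by `norm_num`)
and the tree theorem `durhuusFrohlich_areaLaw_of_slabClustering_holds`. [cite: CaoNissimSheffield2025dynamical, Theorems 1.6 and 2.3] -/
theorem hasAreaLaw_SU_levelTwoBT_six {d : ℕ} (hd : 2 ≤ d) (hN : 6 ≤ N) {β : ℝ} (hβ : 0 ≤ β)
    (h : β * (2 * ((d : ℝ) - 1)) ≤ 3 / 10) : HasAreaLaw d (fundamentalRep (Fin N)) ((N : ℝ) * β) := by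
  have hd1 : (0 : ℝ) ≤ (d : ℝ) - 1 := by
    have : (2 : ℝ) ≤ d := by exact_mod_cast hd
    linarith
  have hR0 : 0 ≤ 2 * ((d : ℝ) - 1) * β := by positivity
  have e : 2 * ((d : ℝ) - 1) * β = β * (2 * ((d : ℝ) - 1)) := by ring
  have hR : 2 * ((d : ℝ) - 1) * β ≤ 3 / 10 := e.le.trans h
  have hmod := levelTwoBT_bracket_local (N₀ := 6) (N := N) (by norm_num) hN (R₀ := 3 / 10) (q := 2243 / 10000) (p := 1129 / 1250)
    (t := 7021 / 50000) (u := 1533 / 25000) (by norm_num) (by norm_num) (by norm_num) (by norm_num) (by norm_num) (by norm_num) (by norm_num)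
    (by norm_num) (by norm_num) (by norm_num)
  refine hasAreaLaw_of_oneLinkKRModulus durhuusFrohlich_areaLaw_of_slabClustering_holds hd (by omega) hβ ?_ h hmod
    (slab_door_of_envelope le_rfl hR hR0 ?_ ?_) <;> norm_num

/-- `d = 4`: **`SU(N)` Wilson AREA LAW for every `N ≥ 6` at every 't Hooft `0 ≤ β ≤ 1 / 20`** (`0.0500`; tree coupling `N·β`;
printed Cao–Nissim–Sheffield: `β < 1/24 ≈ 0.0417`), hypothesis-free. [cite: CaoNissimSheffield2025dynamical, Theorems 1.6 and 2.3] -/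
theorem hasAreaLaw_SU_levelTwoBT_six_d4 (hN : 6 ≤ N) {β : ℝ} (hβ : 0 ≤ β) (h : β ≤ 1 / 20) :
    HasAreaLaw 4 (fundamentalRep (Fin N)) ((N : ℝ) * β) :=
  hasAreaLaw_SU_levelTwoBT_six (d := 4) (by norm_num) hN hβ (by norm_num; linarith)

/-- **`SU(N)` Wilson AREA LAW in every dimension `d ≥ 2`, for every `N ≥ 10` and every 't Hooft `0 ≤ β` with `2(d−1)β ≤ 19 / 60`**
(`d = 4`: `β ≤ 19 / 360 = 0.0528`; `K₂B` column `31/100`; printed Cao–Nissim–Sheffield `β < 1/(8(d−1))`) — hypothesis-free: the slab door with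
the `ω̃`-bootstrap modulus at the bracket `R₀ = 19 / 60`, `q = 1873 / 10000`, `p = 893 / 1000`, `t = 777 / 6250`, `u = 4919 / 100000` (`R₀·K̄₂BT = 0.98745 < 1` by `norm_num`)
and the tree theorem `durhuusFrohlich_areaLaw_of_slabClustering_holds`. [cite: CaoNissimSheffield2025dynamical, Theorems 1.6 and 2.3] -/
theorem hasAreaLaw_SU_levelTwoBT_ten {d : ℕ} (hd : 2 ≤ d) (hN : 10 ≤ N) {β : ℝ} (hβ : 0 ≤ β)
    (h : β * (2 * ((d : ℝ) - 1)) ≤ 19 / 60) : HasAreaLaw d (fundamentalRep (Fin N)) ((N : ℝ) * β) := by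
  have hd1 : (0 : ℝ) ≤ (d : ℝ) - 1 := by
    have : (2 : ℝ) ≤ d := by exact_mod_cast hd
    linarith
  have hR0 : 0 ≤ 2 * ((d : ℝ) - 1) * β := by positivity
  have e : 2 * ((d : ℝ) - 1) * β = β * (2 * ((d : ℝ) - 1)) := by ring
  have hR : 2 * ((d : ℝ) - 1) * β ≤ 19 / 60 := e.le.trans h
  have hmod := levelTwoBT_bracket_local (N₀ := 10) (N := N) (by norm_num) hN (R₀ := 19 / 60) (q := 1873 / 10000) (p := 893 / 1000)
    (t := 777 / 6250) (u := 4919 / 100000) (by norm_num) (by norm_num) (by norm_num) (by norm_num) (by norm_num) (by norm_num) (by norm_num)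
    (by norm_num) (by norm_num) (by norm_num)
  refine hasAreaLaw_of_oneLinkKRModulus durhuusFrohlich_areaLaw_of_slabClustering_holds hd (by omega) hβ ?_ h hmod
    (slab_door_of_envelope le_rfl hR hR0 ?_ ?_) <;> norm_num

/-- `d = 4`: **`SU(N)` Wilson AREA LAW for every `N ≥ 10` at every 't Hooft `0 ≤ β ≤ 19 / 360`** (`0.0528`; tree coupling `N·β`;
printed Cao–Nissim–Sheffield: `β < 1/24 ≈ 0.0417`), hypothesis-free. [cite: CaoNissimSheffield2025dynamical, Theorems 1.6 and 2.3] -/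
theorem hasAreaLaw_SU_levelTwoBT_ten_d4 (hN : 10 ≤ N) {β : ℝ} (hβ : 0 ≤ β) (h : β ≤ 19 / 360) :
    HasAreaLaw 4 (fundamentalRep (Fin N)) ((N : ℝ) * β) :=
  hasAreaLaw_SU_levelTwoBT_ten (d := 4) (by norm_num) hN hβ (by norm_num; linarith)

/-- **`SU(N)` Wilson AREA LAW in every dimension `d ≥ 2`, for every `N ≥ 20` and every 't Hooft `0 ≤ β` with `2(d−1)β ≤ 81 / 250`**
(`d = 4`: `β ≤ 27 / 500 = 0.0540`; `K₂B` column `63/200`; printed Cao–Nissim–Sheffield `β < 1/(8(d−1))`) — hypothesis-free: the slab door with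
the `ω̃`-bootstrap modulus at the bracket `R₀ = 81 / 250`, `q = 106 / 625`, `p = 1111 / 1250`, `t = 289 / 2500`, `u = 4173 / 100000` (`R₀·K̄₂BT = 0.99169 < 1` by `norm_num`)
and the tree theorem `durhuusFrohlich_areaLaw_of_slabClustering_holds`. [cite: CaoNissimSheffield2025dynamical, Theorems 1.6 and 2.3] -/
theorem hasAreaLaw_SU_levelTwoBT_twenty {d : ℕ} (hd : 2 ≤ d) (hN : 20 ≤ N) {β : ℝ} (hβ : 0 ≤ β)
    (h : β * (2 * ((d : ℝ) - 1)) ≤ 81 / 250) : HasAreaLaw d (fundamentalRep (Fin N)) ((N : ℝ) * β) := by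
  have hd1 : (0 : ℝ) ≤ (d : ℝ) - 1 := by
    have : (2 : ℝ) ≤ d := by exact_mod_cast hd
    linarith
  have hR0 : 0 ≤ 2 * ((d : ℝ) - 1) * β := by positivity
  have e : 2 * ((d : ℝ) - 1) * β = β * (2 * ((d : ℝ) - 1)) := by ring
  have hR : 2 * ((d : ℝ) - 1) * β ≤ 81 / 250 := e.le.trans h
  have hmod := levelTwoBT_bracket_local (N₀ := 20) (N := N) (by norm_num) hN (R₀ := 81 / 250) (q := 106 / 625) (p := 1111 / 1250)
    (t := 289 / 2500) (u := 4173 / 100000) (by norm_num) (by norm_num) (by norm_num) (by norm_num) (by norm_num) (by norm_num) (by norm_num)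
    (by norm_num) (by norm_num) (by norm_num)
  refine hasAreaLaw_of_oneLinkKRModulus durhuusFrohlich_areaLaw_of_slabClustering_holds hd (by omega) hβ ?_ h hmod
    (slab_door_of_envelope le_rfl hR hR0 ?_ ?_) <;> norm_num

/-- `d = 4`: **`SU(N)` Wilson AREA LAW for every `N ≥ 20` at every 't Hooft `0 ≤ β ≤ 27 / 500`** (`0.0540`; tree coupling `N·β`;
printed Cao–Nissim–Sheffield: `β < 1/24 ≈ 0.0417`), hypothesis-free. [cite: CaoNissimSheffield2025dynamical, Theorems 1.6 and 2.3] -/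
theorem hasAreaLaw_SU_levelTwoBT_twenty_d4 (hN : 20 ≤ N) {β : ℝ} (hβ : 0 ≤ β) (h : β ≤ 27 / 500) :
    HasAreaLaw 4 (fundamentalRep (Fin N)) ((N : ℝ) * β) :=
  hasAreaLaw_SU_levelTwoBT_twenty (d := 4) (by norm_num) hN hβ (by norm_num; linarith)

/-- **`SU(N)` Wilson AREA LAW in every dimension `d ≥ 2`, for every `N ≥ 50` and every 't Hooft `0 ≤ β` with `2(d−1)β ≤ 49 / 150`**
(`d = 4`: `β ≤ 49 / 900 = 0.0544`; `K₂B` column `317/1000`; printed Cao–Nissim–Sheffield `β < 1/(8(d−1))`) — hypothesis-free: the slab door with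
the `ω̃`-bootstrap modulus at the bracket `R₀ = 49 / 150`, `q = 823 / 5000`, `p = 111 / 125`, `t = 5663 / 50000`, `u = 3937 / 100000` (`R₀·K̄₂BT = 0.99840 < 1` by `norm_num`)
and the tree theorem `durhuusFrohlich_areaLaw_of_slabClustering_holds`. [cite: CaoNissimSheffield2025dynamical, Theorems 1.6 and 2.3] -/
theorem hasAreaLaw_SU_levelTwoBT_fifty {d : ℕ} (hd : 2 ≤ d) (hN : 50 ≤ N) {β : ℝ} (hβ : 0 ≤ β)
    (h : β * (2 * ((d : ℝ) - 1)) ≤ 49 / 150) : HasAreaLaw d (fundamentalRep (Fin N)) ((N : ℝ) * β) := by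
  have hd1 : (0 : ℝ) ≤ (d : ℝ) - 1 := by
    have : (2 : ℝ) ≤ d := by exact_mod_cast hd
    linarith
  have hR0 : 0 ≤ 2 * ((d : ℝ) - 1) * β := by positivity
  have e : 2 * ((d : ℝ) - 1) * β = β * (2 * ((d : ℝ) - 1)) := by ring
  have hR : 2 * ((d : ℝ) - 1) * β ≤ 49 / 150 := e.le.trans h
  have hmod := levelTwoBT_bracket_local (N₀ := 50) (N := N) (by norm_num) hN (R₀ := 49 / 150) (q := 823 / 5000) (p := 111 / 125)
    (t := 5663 / 50000) (u := 3937 / 100000) (by norm_num) (by norm_num) (by norm_num) (by norm_num) (by norm_num) (by norm_num) (by norm_num)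
    (by norm_num) (by norm_num) (by norm_num)
  refine hasAreaLaw_of_oneLinkKRModulus durhuusFrohlich_areaLaw_of_slabClustering_holds hd (by omega) hβ ?_ h hmod
    (slab_door_of_envelope le_rfl hR hR0 ?_ ?_) <;> norm_num

/-- `d = 4`: **`SU(N)` Wilson AREA LAW for every `N ≥ 50` at every 't Hooft `0 ≤ β ≤ 49 / 900`** (`0.0544`; tree coupling `N·β`;
printed Cao–Nissim–Sheffield: `β < 1/24 ≈ 0.0417`), hypothesis-free. [cite: CaoNissimSheffield2025dynamical, Theorems 1.6 and 2.3] -/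
theorem hasAreaLaw_SU_levelTwoBT_fifty_d4 (hN : 50 ≤ N) {β : ℝ} (hβ : 0 ≤ β) (h : β ≤ 49 / 900) :
    HasAreaLaw 4 (fundamentalRep (Fin N)) ((N : ℝ) * β) :=
  hasAreaLaw_SU_levelTwoBT_fifty (d := 4) (by norm_num) hN hβ (by norm_num; linarith)

/-- The area-law radii of this column against the printed all-`N` constant `1/4` (Cao–Nissim–Sheffield) and the `K₂B` column:
`1/4 < 69/250 < 139/500`, `119/400 < 3/10`, `31/100 < 19/60`, `63/200 < 81/250`, `317/1000 < 49/150 < 1/2`; `d = 4`: `1/24 < 1/20 = (3/10)/6`. [folklore] -/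
theorem areaLaw_numbers_levelTwoBT :
    (1 : ℝ) / 4 < 69 / 250 ∧ (69 : ℝ) / 250 < 139 / 500 ∧ (119 : ℝ) / 400 < 3 / 10 ∧ (31 : ℝ) / 100 < 19 / 60 ∧
      (63 : ℝ) / 200 < 81 / 250 ∧ (317 : ℝ) / 1000 < 49 / 150 ∧ (49 : ℝ) / 150 < 1 / 2 ∧ (1 : ℝ) / 24 < (3 / 10) / 6 := by
  norm_num

end LevelTwoBTAreaLaw

end Summit.Ventures.YMGap.OneLinkEigen
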